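/-
Copyright (c) 2026. All rights reserved.
Released under Apache 2.0 license as described in the file LICENSE.
-/
import Summits.CriticalPhenomena.LaceExpansionHighD.NobleBoundsNSharpBordered
import HarnessLib

/-!
# Fitzner–van der Hofstad (2017), Prop. 5.5 (5.34) at `N = M + 2` against the SHARP blocks, hypothesis-free — Part V
§RealComponents–§ASharpRows (capstone): the turnkey numerics interface of the Sharp chain: COMPONENT real majorants
⇒ the real `N ≥ 2` rows with middle matrix `sharpMidR = B′ℝ + A*ℝ·A♯ℝ + [b=2]·Aιℝ·psℝ`
(`nobleXiN_perN_of_sharpComponentMajorants`), the scalar `Σ_{z≠0}P^{0}(z,z) = (A)_{0,0}` and the closed forms of the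
six non-zero entries of the `x = 0` slice matrix `(A♯) = matB₀ (blockASharp L)`; importing this module imports the
whole chain (WHAT-IF, DIVERGENCE D77; b2b-lace LEMMAS node N76-X2-D77, module 11/11)

[FvdH17] = R. Fitzner, R. van der Hofstad, *Mean-field behavior for nearest-neighbor percolation in `d > 10`*,
arXiv:1506.07977v2 (EJP 22 (2017), paper 43).  Page numbers refer to the arXiv version.

CHAIN OVERVIEW (the eleven modules together; this capstone imports them all):
The b2b-lace coding of a generic two-level piece (`NobleCodingMid.exists_laceCodingMid`, [FvdH17] §4.4 after (4.66),
p. 42) produces, besides the printed classes of (4.61)–(4.66), two residues not covered by the printed Tables of App. B: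
the CORNER `R′ = F‴ ∩ {w_{k+1} = t_k}` (the exit route leaves the backbone AT the first point of the last sausage; the
printed Table `A^{a,b}`, p. 74, has "`x, y ≠ 0`") and the CUT-THROUGH `R = F″ ∩ {z_k = t_k ∼ w_{k+1}, t_k ≠ u_{k+1}}`
(row `(a,1)` on a one-bond segment in column 2).  `Summits/…/NobleBlocksSharp` defines the honest local letters for them
(`blockASharp` = the `x = 0` slice `A♯^{c,a′}`, `blockT2Sharp`, rows `blockXRPrime` / `blockXR`, payload `blockBSharpFull`).
The eleven modules prove [FvdH17] Prop. 5.5 (5.34) at `N = M + 2` against `secStarBpt (blockBSharpFull L) 2 0 …` with NO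
slot hypothesis:
* Part I (§A–§F): the corner cell packages — middle / first junction and middle lower-`★` pair — against `A♯`
  (targets `blockXRPrime L c …`), bodies = the off-corner `F‴` packages of `NobleBoundsNMidSOpen` /
  `NobleBoundsNFirstSOpen` / `NobleBoundsNLowStar` verbatim except for the exit letter;
* Part II (§A–§E): the corner cut-through cell packages (targets `tgtRegB … (true,0) + blockXR …`), bodies = the
  `F″` cut-through packages of `NobleBoundsNMidECut` / `NobleBoundsNFirstECut` / `NobleBoundsNLowE` verbatim except that
  the third `A`-line `{w′ ←(≥1)→ t}` is split at the event level into `{w′ ←(≥2)→ t} ∪ {w′ ←1̲→ t}`;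
* Part III (§A–§F): the Sharp targets `cellS`/`tgtRegS`/`tgtStarLS`/`tgtJS`, their column bounds against
  `blockXSharp`/`blockBSharpFull`, the closing form and (5.34) modulo the six Sharp slots
  (`tsum_nobleXiT_le_secStarBSharp_of_sharpSlots`), twin of `Literature/…/NobleBoundsNResidualB`;
* Part IV (§G): the six slots discharged from Parts I–II and the hypothesis-free `tsum_nobleXiT_le_secStarBSharp`.
* Part V: the two algebraic steps to the numerics interface, mirroring the print chain's
  `tsum_nobleXiT_le_bordered'_of_cover` and `nobleXiN_perN_of_chain`: the bordered `3 × 3` form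
  `tsum_nobleXiT_le_borderedBSharp` and the real `N ≥ 2` rows `nobleXiN_perN_of_sharpMajorants` from entrywise real
  majorants of `vecPS`, `vecPE`, `matB (blockBFullB' L (blockX₂Sharp L))`, `matAbar (blockAbar' L)` (the `hN` of
  `NobleNSums.NSumLE_rows_of_bounds`), and the payload split for the numerics side `matB_blockBSharp_le`:
  `(B♯′)_{a,b} ≤ (B′)_{a,b} + Σ_c (A'^{ι,*})_{a,c}(A♯)_{c,b} + 𝟙{b=2}(A^{ι})_{a,1}Σ_{z≠0}P^{0}(z,z)` — the `x = 0`
  slice matrix `(A♯) = matB₀ (blockASharp L)` being the only numeric object not already in the printed tables.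
  Turnkey numerics interface `nobleXiN_perN_of_sharpComponentMajorants`: COMPONENT real majorants (`P⃗^S, P⃗^E, (B′), (A'^{ι,*}),`
  `(A♯) = matB₀ (blockASharp L)`, the column `(A^{ι})_{·,1}`, the scalar `Σ_{z≠0}P^{0}(z,z)`, `(Ā′)`) ⇒ the real `N ≥ 2` rows with
  middle matrix `sharpMidR = B′ℝ + A*ℝ·A♯ℝ + [b=2]·Aιℝ·psℝ`.
  Numerics leaves typed: the scalar is the printed `(A)_{0,0}` (`tsum_kdc_blockPS_zero_eq_matA`) and the six
  non-zero entries of `(A♯)` have closed forms `matB₀_blockASharp_zero_one` … `_two_two` (§ASharpRows).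
MODULE MAP: Part I = `NobleBoundsNMidSCornerLetter` (§A–§C), `NobleBoundsNMidSCornerMid` (§D),
`NobleBoundsNMidSCornerFirst` (§E), `NobleBoundsNMidSCornerLow` (§F); Part II = `NobleBoundsNMidECutRMid` (§A–§C),
`NobleBoundsNMidECutRFirstLow` (§D–§E); Part III = `NobleBoundsNResidualSharpTargets` (§A–§D),
`NobleBoundsNResidualSharpSizeModel` (§E–§F); Part IV = `NobleBoundsNSharpSlots` (§G); Part V = `NobleBoundsNSharpBordered`
(bordered form, payload split, real rows) and this module (component majorants, `(A♯)` closed forms).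

SPLIT PROVENANCE: module 11 of 11 of the b2b-lace node N76-X2-D77 (what-if, DIVERGENCE D77) — the 11 modules are the
section-seam split (carver-g217, 2026-08-27) of the single-module form `NobleBoundsNSharpD77.lean` (carver-g51
text-final, sha256 `877e12977f9f9c92`, 2707 lines): every declaration, statement and proof is carried over verbatim and
in the original order; only module boundaries, the repeated `section`/`variable` headers and two docstrings were added.
PLACEMENT: what-if objects of `NobleBlocksSharp` (b2b-lace LEAN PLACEMENT RULE, REFEREE R491), hence
`namespace Summit.CriticalPhenomena.LaceExpansionHighD.NobleBlocks`.  Conventions: `d`-generic; every declaration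
carries its [FvdH17] display / page cite in the docstring; NOTHING is cited as a fact (b2b-lace ABSOLUTE RULE);
additive (no existing declaration is changed). -/

noncomputable section

namespace Summit.CriticalPhenomena.LaceExpansionHighD.NobleBlocks

open Literature.Probability.FitznerVanDerHofstad2017 Literature.Probability.FitznerVanDerHofstad2017.NobleBlocks
open Literature.Probability.FitznerVanDerHofstad2017.NobleBlocks.LenIdx
open Literature.Probability.LatticeModels Literature.Probability.Percolation
open Literature.Probability.FitznerVanDerHofstad2017.BlockSummation
open Literature.Barriers.CriticalPhenomena
open Literature.Combinatorics.SimpleGraph _root_.SimpleGraph _root_.MeasureTheory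
open scoped BigOperators ENNReal Matrix

variable {d : ℕ}

section RealComponents

/-- Entrywise real majorants multiply: if `M ≤ ofReal Mℝ` and `N ≤ ofReal Nℝ` entrywise with `Mℝ, Nℝ ≥ 0`, then
`(M * N) a b ≤ ofReal ((Mℝ * Nℝ) a b)`. -/
theorem mul_apply_le_ofReal_mul {m n l : Type*} [Fintype n] {M : Matrix m n ℝ≥0∞} {N : Matrix n l ℝ≥0∞}
    {MR : Matrix m n ℝ} {NR : Matrix n l ℝ} (hM0 : ∀ a c, 0 ≤ MR a c) (hN0 : ∀ c b, 0 ≤ NR c b)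
    (hM : ∀ a c, M a c ≤ ENNReal.ofReal (MR a c)) (hN : ∀ c b, N c b ≤ ENNReal.ofReal (NR c b)) (a : m) (b : l) :
    (M * N) a b ≤ ENNReal.ofReal ((MR * NR) a b) := by
  rw [Matrix.mul_apply, Matrix.mul_apply, ENNReal.ofReal_sum_of_nonneg (fun c _ => mul_nonneg (hM0 a c) (hN0 c b))]
  refine Finset.sum_le_sum fun c _ => ?_
  rw [ENNReal.ofReal_mul (hM0 a c)]
  exact mul_le_mul' (hM a c) (hN c b)

/-- The real middle matrix assembled from COMPONENT majorants (see `matB_blockBSharp_le`):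
`B♯ℝ := B′ℝ + A*ℝ · A♯ℝ + [b = 2] · Aιℝ_a · psℝ`. -/
def sharpMidR (B0R ASR AShR : Matrix (Fin 3) (Fin 3) ℝ) (aιR : Fin 3 → ℝ) (psR : ℝ) : Matrix (Fin 3) (Fin 3) ℝ :=
  B0R + ASR * AShR + Matrix.of fun a b => if b = 2 then aιR a * psR else 0

/-- Entry formula of `sharpMidR`: `(B♯ℝ)_{a,b} = B′ℝ_{a,b} + (A*ℝ · A♯ℝ)_{a,b} + [b = 2] · Aιℝ_a · psℝ`. -/
theorem sharpMidR_apply (B0R ASR AShR : Matrix (Fin 3) (Fin 3) ℝ) (aιR : Fin 3 → ℝ) (psR : ℝ) (a b : Fin 3) :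
    sharpMidR B0R ASR AShR aιR psR a b = B0R a b + (ASR * AShR) a b + (if b = 2 then aιR a * psR else 0) := by
  simp only [sharpMidR, Matrix.add_apply, Matrix.of_apply]

/-- `sharpMidR` has non-negative entries when all its component majorants are non-negative. -/
theorem sharpMidR_nonneg {B0R ASR AShR : Matrix (Fin 3) (Fin 3) ℝ} {aιR : Fin 3 → ℝ} {psR : ℝ}
    (hB00 : ∀ a b, 0 ≤ B0R a b) (hAS0 : ∀ a c, 0 ≤ ASR a c) (hASh0 : ∀ c b, 0 ≤ AShR c b) (hι0 : ∀ a, 0 ≤ aιR a)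
    (hps0 : 0 ≤ psR) (a b : Fin 3) : 0 ≤ sharpMidR B0R ASR AShR aιR psR a b := by
  rw [sharpMidR_apply]
  refine add_nonneg (add_nonneg (hB00 a b) ?_) ?_
  · rw [Matrix.mul_apply]
    exact Finset.sum_nonneg fun c _ => mul_nonneg (hAS0 a c) (hASh0 c b)
  · split_ifs
    · exact mul_nonneg (hι0 a) hps0
    · exact le_rfl

variable (L : Letters d)

/-- **Component majorants ⇒ a majorant of the Sharp middle matrix**: from entrywise real majorants `B′ℝ` of
`matB (blockBFullB' L 0)` (the printed `(B′)`), `A*ℝ` of `matB (blockAiotaSt' L)`, `A♯ℝ` of the `x = 0` slice matrix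
`matB₀ (blockASharp L)`, `Aιℝ` of the column `matB (blockAiota' L) · 1` and `psℝ` of `Σ_{z≠0} P^{0}(z,z)`,
`matB (blockBFullB' L (blockX₂Sharp L)) a b ≤ ofReal (sharpMidR B′ℝ A*ℝ A♯ℝ Aιℝ psℝ a b)` (by `matB_blockBSharp_le`).
[cite: FitznerVanDerHofstad2017, §5.1 "Elements of the bounds" (arXiv:1506.07977v2 p. 49); §4.4 (4.62)/(4.64) (pp. 41–42); App. B (pp. 73–75)] -/
theorem matB_blockBSharp_le_ofReal_sharpMidR {B0R ASR AShR : Matrix (Fin 3) (Fin 3) ℝ} {aιR : Fin 3 → ℝ} {psR : ℝ}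
    (hB00 : ∀ a b, 0 ≤ B0R a b) (hAS0 : ∀ a c, 0 ≤ ASR a c) (hASh0 : ∀ c b, 0 ≤ AShR c b) (hι0 : ∀ a, 0 ≤ aιR a)
    (hps0 : 0 ≤ psR)
    (hB0 : ∀ a b, matB (blockBFullB' L 0) a b ≤ ENNReal.ofReal (B0R a b))
    (hAS : ∀ a c, matB (blockAiotaSt' L) a c ≤ ENNReal.ofReal (ASR a c))
    (hASh : ∀ c b, matB₀ (blockASharp L) c b ≤ ENNReal.ofReal (AShR c b))
    (hι : ∀ a, matB (blockAiota' L) a 1 ≤ ENNReal.ofReal (aιR a))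
    (hps : ∑' z, kdc z 0 * blockPS L 0 z z ≤ ENNReal.ofReal psR) (a b : Fin 3) :
    matB (blockBFullB' L (blockX₂Sharp L)) a b ≤ ENNReal.ofReal (sharpMidR B0R ASR AShR aιR psR a b) := by
  refine (matB_blockBSharp_le L a b).trans ?_
  have nn2 : 0 ≤ (ASR * AShR) a b := by
    rw [Matrix.mul_apply]
    exact Finset.sum_nonneg fun c _ => mul_nonneg (hAS0 a c) (hASh0 c b)
  have nn3 : 0 ≤ (if b = 2 then aιR a * psR else 0) := by
    split_ifs
    · exact mul_nonneg (hι0 a) hps0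
    · exact le_rfl
  have h2 : (matB (blockAiotaSt' L) * matB₀ (blockASharp L)) a b ≤ ENNReal.ofReal ((ASR * AShR) a b) :=
    mul_apply_le_ofReal_mul hAS0 hASh0 hAS hASh a b
  have h3 : (if b = 2 then matB (blockAiota' L) a 1 * ∑' z, kdc z 0 * blockPS L 0 z z else 0) ≤
      ENNReal.ofReal (if b = 2 then aιR a * psR else 0) := by
    split_ifs
    · rw [ENNReal.ofReal_mul (hι0 a)]
      exact mul_le_mul' (hι a) hps
    · simp
  rw [sharpMidR_apply, ENNReal.ofReal_add (add_nonneg (hB00 a b) nn2) nn3, ENNReal.ofReal_add (hB00 a b) nn2]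
  exact add_le_add (add_le_add (hB0 a b) h2) h3

/-- **Leaf N♯2 is a printed object**: the scalar of the column-2 vertex term, `Σ_z 𝟙{z≠0}·P^{S,0}(z,z) = Σ_{x≠0} P̃(0⇔x)`,
is exactly the entry `(A)_{0,0}` of the printed matrix `A` (`matA L 0 0`, `NobleElementsClosedForms.matA_zero_zero`), so the
majorant `psℝ` of `nobleXiN_perN_of_sharpComponentMajorants` may be taken to be the certified majorant of `(A)_{0,0}`.
[cite: FitznerVanDerHofstad2017, App. B Tables "definition of P^b(x,y)" row b = 0 (arXiv:1506.07977v2 p. 73) and "definition of A^{a,b}(0,v,x,y)" row (0,0) (p. 74)] -/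
theorem tsum_kdc_blockPS_zero_eq_matA : ∑' z, kdc z 0 * blockPS L 0 z z = matA L 0 0 := by
  rw [matA_zero_zero]
  refine tsum_congr fun z => ?_
  rw [blockPS_zero, kd_self, one_mul]

variable (p : unitInterval)

/-- **The real `N ≥ 2` rows from `(5.34)♯` and COMPONENT majorants** (the turnkey numerics interface of the Sharp
chain): non-negative real majorants `uℝ, wℝ` of `P⃗^S, P⃗^E`, `B′ℝ` of the printed `(B′) = matB (blockBFullB' L 0)`,
`A*ℝ` of `(A'^{ι,*}) = matB (blockAiotaSt' L)`, `A♯ℝ` of the `x = 0` slice matrix `(A♯) = matB₀ (blockASharp L)`, `Aιℝ` of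
the column `(A^{ι})_{·,1}`, `psℝ` of `Σ_{z≠0}P^{0}(z,z)` and `Aℝ` of `(Ā′) = matAbar (blockAbar' L)` (`L = Letters.perc d p`) give,
for every `N ≥ 2`, `Summable Ξ^{(N)}` and
`Σ_x Ξ^{(N)}(x) ≤ (uℝ,0) · ([[B♯ℝ, B♯ℝ_{·,0}],[B♯ℝ_{2,·}, B♯ℝ_{2,0}]]^{N−1} · [[Aℝ,0],[Aℝ_{2,·},0]]) · (wℝ,0)` with
`B♯ℝ = sharpMidR B′ℝ A*ℝ A♯ℝ Aιℝ psℝ = B′ℝ + A*ℝ·A♯ℝ + [b=2]·Aιℝ_a·psℝ` — the `hN` of `NobleNSums.NSumLE_rows_of_bounds`.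
[cite: FitznerVanDerHofstad2017, Prop. 5.5 (5.34) (arXiv:1506.07977v2 p. 53); Remark 2.3 (pp. 12–13); §5.1 (p. 49); §5.4 (p. 56); §4.4 (4.64) (p. 42)] -/
theorem nobleXiN_perN_of_sharpComponentMajorants {uR wR aιR : Fin 3 → ℝ}
    {B0R ASR AShR AR : Matrix (Fin 3) (Fin 3) ℝ} {psR : ℝ}
    (hu0 : ∀ a, 0 ≤ uR a) (hw0 : ∀ b, 0 ≤ wR b) (hB00 : ∀ a b, 0 ≤ B0R a b) (hAS0 : ∀ a c, 0 ≤ ASR a c)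
    (hASh0 : ∀ c b, 0 ≤ AShR c b) (hι0 : ∀ a, 0 ≤ aιR a) (hps0 : 0 ≤ psR) (hA0 : ∀ a b, 0 ≤ AR a b)
    (hu : ∀ a, vecPS (Letters.perc d p) a ≤ ENNReal.ofReal (uR a))
    (hw : ∀ b, vecPE (Letters.perc d p) b ≤ ENNReal.ofReal (wR b))
    (hB0 : ∀ a b, matB (blockBFullB' (Letters.perc d p) 0) a b ≤ ENNReal.ofReal (B0R a b))
    (hAS : ∀ a c, matB (blockAiotaSt' (Letters.perc d p)) a c ≤ ENNReal.ofReal (ASR a c))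
    (hASh : ∀ c b, matB₀ (blockASharp (Letters.perc d p)) c b ≤ ENNReal.ofReal (AShR c b))
    (hι : ∀ a, matB (blockAiota' (Letters.perc d p)) a 1 ≤ ENNReal.ofReal (aιR a))
    (hps : ∑' z, kdc z 0 * blockPS (Letters.perc d p) 0 z z ≤ ENNReal.ofReal psR)
    (hA : ∀ a b, matAbar (blockAbar' (Letters.perc d p)) a b ≤ ENNReal.ofReal (AR a b)) :
    ∀ N, 2 ≤ N → Summable (nobleXiN d p N) ∧
      ∑' x, nobleXiN d p N x ≤
        Sum.elim uR (0 : Unit → ℝ) ⬝ᵥ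
          ((Matrix.fromBlocks (sharpMidR B0R ASR AShR aιR psR)
                (Matrix.of fun (a : Fin 3) (_ : Unit) => sharpMidR B0R ASR AShR aιR psR a 0)
                (Matrix.of fun (_ : Unit) (a' : Fin 3) => sharpMidR B0R ASR AShR aιR psR 2 a')
                (Matrix.of fun (_ : Unit) (_ : Unit) => sharpMidR B0R ASR AShR aιR psR 2 0) ^ (N - 1) *
            Matrix.fromBlocks AR (0 : Matrix (Fin 3) Unit ℝ) (Matrix.of fun (_ : Unit) (c : Fin 3) => AR 2 c)
              (0 : Matrix Unit Unit ℝ)) *ᵥ Sum.elim wR (0 : Unit → ℝ)) :=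
  nobleXiN_perN_of_sharpMajorants p hu0 hw0 (sharpMidR_nonneg hB00 hAS0 hASh0 hι0 hps0) hA0 hu hw
    (matB_blockBSharp_le_ofReal_sharpMidR (Letters.perc d p) hB00 hAS0 hASh0 hι0 hps0 hB0 hAS hASh hι hps) hA

end RealComponents

section ASharpRows

variable (L : Letters d)

/-- Row `c = 0` of the `x = 0` slice matrix `(A♯)`: the closed bubble `(A♯)_{0,1} = Σ_{y≠0} τ_{1̲}(y)·τ_{≥1}(−y)`
(`= Σ_y (1−δ_{y,0}) B_{1̲,(≥1)}(y,0)`). [cite: FitznerVanDerHofstad2017, App. B Table "definition of A^{a,b}(0,v,x,y)" row (0,1) (arXiv:1506.07977v2 p. 74); §5.1 "Elements of the bounds" (p. 49); §4.4 (4.64) (p. 42)] -/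
theorem matB₀_blockASharp_zero_one : matB₀ (blockASharp L) 0 1 = ∑' y, kdc y 0 * L.B (.eq 1) (.ge 1) y 0 := by
  have h : ∀ v x y, blockASharp L 0 1 0 v x y = kd x 0 * kdc y 0 * (kd v 0 * L.B (.eq 1) (.ge 1) y v) :=
    fun v x y => by rw [blockASharp, ofBase_zero]; rfl
  rw [matB₀_apply, normB_eq_of_v_zero _ fun v hv x y => by rw [h, kd_of_ne hv]; simp]
  simp only [h, kd_self, one_mul, mul_assoc]
  simp only [ENNReal.tsum_mul_left]
  exact tsum_kd_mul 0 fun _ => ∑' y, kdc y 0 * L.B (.eq 1) (.ge 1) y 0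

/-- Row `c = 0`: `(A♯)_{0,2} = Σ_{y≠0} τ_{≥2}(y)·τ_{≥1}(−y)`. [cite: FitznerVanDerHofstad2017, App. B Table "definition of A^{a,b}(0,v,x,y)" row (0,2) (arXiv:1506.07977v2 p. 74); §5.1 (p. 49); §4.4 (4.64) (p. 42)] -/
theorem matB₀_blockASharp_zero_two : matB₀ (blockASharp L) 0 2 = ∑' y, kdc y 0 * L.B (.ge 2) (.ge 1) y 0 := by
  have h : ∀ v x y, blockASharp L 0 2 0 v x y = kd x 0 * kdc y 0 * (kd v 0 * L.B (.ge 2) (.ge 1) y v) :=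
    fun v x y => by rw [blockASharp, ofBase_zero]; rfl
  rw [matB₀_apply, normB_eq_of_v_zero _ fun v hv x y => by rw [h, kd_of_ne hv]; simp]
  simp only [h, kd_self, one_mul, mul_assoc]
  simp only [ENNReal.tsum_mul_left]
  exact tsum_kd_mul 0 fun _ => ∑' y, kdc y 0 * L.B (.ge 2) (.ge 1) y 0

/-- Row `c = 1`: `(A♯)_{1,1} = sup_v 2dD(v)·Σ_{y≠0} τ_{1̲}(y)·τ_{≥1}(v−y)`. [cite: FitznerVanDerHofstad2017, App. B Table "definition of A^{a,b}(0,v,x,y)" row (1,1) (arXiv:1506.07977v2 p. 74); §5.1 (p. 49); §4.4 (4.64) (p. 42)] -/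
theorem matB₀_blockASharp_one_one :
    matB₀ (blockASharp L) 1 1 = ⨆ v, twoDD v * ∑' y, kdc y 0 * L.B (.eq 1) (.ge 1) y v := by
  have h0 : ∀ v x y, blockASharp L 1 1 0 v x y = kd x 0 * kdc y 0 * (twoDD v * L.B (.eq 1) (.ge 1) y v) :=
    fun v x y => by rw [blockASharp, ofBase_zero]; rfl
  have h : ∀ v x y, blockASharp L 1 1 0 v x y = kd x 0 * (twoDD v * (kdc y 0 * L.B (.eq 1) (.ge 1) y v)) :=
    fun v x y => by rw [h0]; ring
  rw [matB₀_apply]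
  show (⨆ v, ∑' x, ∑' y, blockASharp L 1 1 0 v x y) = _
  refine iSup_congr fun v => ?_
  simp only [h, ENNReal.tsum_mul_left]
  exact tsum_kd_mul 0 fun _ => twoDD v * ∑' y, kdc y 0 * L.B (.eq 1) (.ge 1) y v

/-- Row `c = 1`: `(A♯)_{1,2} = sup_v 2dD(v)·Σ_{y≠0} τ_{≥2}(y)·τ_{≥1}(v−y)`. [cite: FitznerVanDerHofstad2017, App. B Table "definition of A^{a,b}(0,v,x,y)" row (1,2) (arXiv:1506.07977v2 p. 74); §5.1 (p. 49); §4.4 (4.64) (p. 42)] -/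
theorem matB₀_blockASharp_one_two :
    matB₀ (blockASharp L) 1 2 = ⨆ v, twoDD v * ∑' y, kdc y 0 * L.B (.ge 2) (.ge 1) y v := by
  have h0 : ∀ v x y, blockASharp L 1 2 0 v x y = kd x 0 * kdc y 0 * (twoDD v * L.B (.ge 2) (.ge 1) y v) :=
    fun v x y => by rw [blockASharp, ofBase_zero]; rfl
  have h : ∀ v x y, blockASharp L 1 2 0 v x y = kd x 0 * (twoDD v * (kdc y 0 * L.B (.ge 2) (.ge 1) y v)) :=
    fun v x y => by rw [h0]; ring
  rw [matB₀_apply]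
  show (⨆ v, ∑' x, ∑' y, blockASharp L 1 2 0 v x y) = _
  refine iSup_congr fun v => ?_
  simp only [h, ENNReal.tsum_mul_left]
  exact tsum_kd_mul 0 fun _ => twoDD v * ∑' y, kdc y 0 * L.B (.ge 2) (.ge 1) y v

/-- Row `c = 2`: the open bubble `(A♯)_{2,1} = sup_v Σ_{y≠0} τ_{1̲}(y)·τ_{≥1}(v−y)`. [cite: FitznerVanDerHofstad2017, App. B Table "definition of A^{a,b}(0,v,x,y)" row (2,1) (arXiv:1506.07977v2 p. 74); §5.1 (p. 49); §4.4 (4.64) (p. 42)] -/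
theorem matB₀_blockASharp_two_one :
    matB₀ (blockASharp L) 2 1 = ⨆ v, ∑' y, kdc y 0 * L.B (.eq 1) (.ge 1) y v := by
  have h0 : ∀ v x y, blockASharp L 2 1 0 v x y = kd x 0 * kdc y 0 * L.B (.eq 1) (.ge 1) y v :=
    fun v x y => by rw [blockASharp, ofBase_zero]; rfl
  have h : ∀ v x y, blockASharp L 2 1 0 v x y = kd x 0 * (kdc y 0 * L.B (.eq 1) (.ge 1) y v) :=
    fun v x y => by rw [h0]; ring
  rw [matB₀_apply]
  show (⨆ v, ∑' x, ∑' y, blockASharp L 2 1 0 v x y) = _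
  refine iSup_congr fun v => ?_
  simp only [h, ENNReal.tsum_mul_left]
  exact tsum_kd_mul 0 fun _ => ∑' y, kdc y 0 * L.B (.eq 1) (.ge 1) y v

/-- Row `c = 2`: the open bubble `(A♯)_{2,2} = sup_v Σ_{y≠0} τ_{≥2}(y)·τ_{≥1}(v−y)`. [cite: FitznerVanDerHofstad2017, App. B Table "definition of A^{a,b}(0,v,x,y)" row (2,2) (arXiv:1506.07977v2 p. 74); §5.1 (p. 49); §4.4 (4.64) (p. 42)] -/
theorem matB₀_blockASharp_two_two :
    matB₀ (blockASharp L) 2 2 = ⨆ v, ∑' y, kdc y 0 * L.B (.ge 2) (.ge 1) y v := by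
  have h0 : ∀ v x y, blockASharp L 2 2 0 v x y = kd x 0 * kdc y 0 * L.B (.ge 2) (.ge 1) y v :=
    fun v x y => by rw [blockASharp, ofBase_zero]; rfl
  have h : ∀ v x y, blockASharp L 2 2 0 v x y = kd x 0 * (kdc y 0 * L.B (.ge 2) (.ge 1) y v) :=
    fun v x y => by rw [h0]; ring
  rw [matB₀_apply]
  show (⨆ v, ∑' x, ∑' y, blockASharp L 2 2 0 v x y) = _
  refine iSup_congr fun v => ?_
  simp only [h, ENNReal.tsum_mul_left]
  exact tsum_kd_mul 0 fun _ => ∑' y, kdc y 0 * L.B (.ge 2) (.ge 1) y v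

/-- Column `b = 0` of `(A♯)` vanishes. [cite: FitznerVanDerHofstad2017, App. B Table "definition of A^{a,b}(0,v,x,y)" (arXiv:1506.07977v2 p. 74)] -/
theorem matB₀_blockASharp_col_zero (c : Fin 3) : matB₀ (blockASharp L) c 0 = 0 := by
  rw [matB₀_apply]
  show (⨆ v, ∑' x, ∑' y, blockASharp L c 0 0 v x y) = 0
  simp [blockASharp_zero]

end ASharpRows

end Summit.CriticalPhenomena.LaceExpansionHighD.NobleBlocks

end
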